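import Summits.ResolutionOfSingularities.ResolutionOfSingularities.Theorems.MarkedTransferCampaignW31EdgePieceBridge
import Summits.ResolutionOfSingularities.ResolutionOfSingularities.Theorems.MarkedTransferCampaignW31InvWellDefined
import Literature.AlgebraicGeometry.Hironaka2017.Proofs.S04CharAlgebra.U20p3
import Summits.ResolutionOfSingularities.ResolutionOfSingularities.Theorems.MarkedTransferCampaignW31UscAssembly
import Summits.ResolutionOfSingularities.ResolutionOfSingularities.Theorems.MarkedTransferCampaignW31EdgeHilbLscProof
import HarnessLib

/-!
# [OURS · L1 W3.1] Piece (ii) — the DICTIONARY `dim_{κ(ξ)} G(ξ)_a = N(q(D); a)` — FOLLOWS from the typed candidate `U19_4`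
# («`G` is Diff-closed», §4.1 (8) p.19); hence the slot statement `CampaignW31UscInvOneExponentI p` modulo `U19_4` + (iii)
# (seat res-L1-s31-pv-3)

Cell `res-hironaka` (run/shared/lean/pub/res-hironaka/), rung L (rescue) of LADDER-RESOLUTION, slot W3.1 «u.s.c. first»
(positive rung, verdict-free). HOST (custody, no new route): the existing crux `Theses.MarkedTransfer.HypersurfaceOrderReduction`
stmt-ResolutionOfSingularities-16155, `--supports … --as helper`, as every W3.1 file. Builds on: statements p463247/p464862 (o4),
assembly p467881 (k31), (i) `CampaignW31EdgeHilbLsc_holds` p474858 (pv-2), `campaignW31InvWellDefinedI_holds` + the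
standard-base lemmas p472731 (res-type-005), the edge-piece bridge p477733 (pv-3), and the HIRONAKA-L discharge lane's
`S04CharAlgebra.EdgeCone.*` (Itm411/Itm413), `U20_3_holds` (U20p3: residue fields at closed points are perfect).

HONEST FRAMING. Everything below is OURS-side algebra over OUR typed carriers or pure logic; NOTHING here is a statement of
H. Hironaka's manuscript *Resolution of singularities in positive characteristics* (2017-03-23, [Hironaka2017], lit key
`paper:url-3343fd9e678b`). ONE typed candidate of the manuscript is CONSUMED AS A HYPOTHESIS, never asserted:
`S04CharAlgebra.U19_4 p f E` (R004bEdgeGenerators, §4.1 (8) p.19 l.31–32 «so that `G` must be Diff-closed in view of Eq.(22)»: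
row 004's set `edgeG (℘(E)_ξ) z ⊆ κ(ξ)[Z]` is stable under every `κ(ξ)`-linear differential operator of `κ(ξ)[Z]`), for every
perfect ambient datum; every theorem that uses it says so in its signature (the gate records a conditional result). No
FACT-LIST fact is consumed. AI-produced; weaker than expert review.

## What is proved (sorry-free; axioms ⊆ {propext, Classical.choice, Quot.sound})

Local algebra (`(O, 𝔪, κ)` local, `z` generating `𝔪`, `P ⊆ O[X]`, `U ⊆ κ[Z]` the `κ`-subalgebra with carrier `edgeG P z`):
* `isDiffStable_of_coe_eq_edgeG` — Diff-closedness of `edgeG P z` (the shape of `U19_4`) ⇒ `U` is stable under all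
  Hasse–Schmidt derivations (tree `Resolution.IsDiffStable`, `hasseDeriv_mem_diffOp`).
* `isMinHomogGens_presentation` — a presentation `U = κ[ℓ_1^{q_1},…,ℓ_r^{q_r}]` (tree `EdgeAlgebra.Presentation`, from
  `Resolution.exists_eq_adjoin_pow_linearForms_of_isDiffStable`) IS a minimum system of homogeneous generators (row 004's
  `IsMinHomogGens`) of the edge ideal `(edgeGPos n P z)` (row 005): positive-degree homogeneous members of `κ[S]` lie in
  `(S)` (`mem_span_of_mem_adjoin_of_isHomogeneous`); irredundancy by the retraction `ℓ_j ↦ Y_j` (tree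
  `exists_algHom_linearForm_eq_X`) and evaluation at a coordinate point (`X_pow_notMem_span_image`).
* `hilbFun_eq_hilb_of_isMinHomogGens` — for `κ` perfect of characteristic `p`, `U` graded and Hasse–Schmidt stable, and ANY
  minimum system of homogeneous generators `ḡ` of `(edgeGPos n P z)` with non-decreasing degrees `q`:
  `dim_κ (U ∩ κ[Z]_a) = N(q; a)` for all `a` — `ḡ` and the presentation are both Cossart–Jannsen–Saito standard bases of the
  same ideal (res-type-005's `isStandardBase_of_isMinHomogGens`), so their degree sequences coincide
  (`ofFn_eq_of_isStandardBase`, CJS Lemma 2.2; `hilb_eq_of_ofFn_eq`).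
Scheme level:
* **`campaignW31EdgeHilbDictionary_of_U19_4`**: `(∀ K A E, U19_4 p A.hom E) → CampaignW31EdgeHilbDictionary p` — piece (ii).
  Route: `A.Z` regular (smooth over a field) and locally Noetherian; the provenance datum of `D` supplies an r.s.p. `z`
  (`IsRSP`, regularity of `O_ξ`) and a minimum system `ḡ` with `deg ḡ_j = q_j(D)` sorted (res-type-005's `monotone_q`);
  `edgeHilbAt E ξ a = hilbFun U a` (bridge p477733) `= N(q(D); a)`.
* **`campaignW31UscInvOneExponentI_of_U19_4`**: `(∀ K A E, U19_4 p A.hom E) → CampaignW31EdgeHilbFiniteRange p →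
  CampaignW31UscInvOneExponentI p` — THE SLOT STATEMENT (u.s.c. of `ξ ↦ Inv_ξ(E)` on `Sing(E)_cl` for one standard `E`)
  modulo the typed candidate `U19_4` and piece (iii); likewise `campaignW31InvmaxClosedI_of_U19_4`.

## What remains for the slot

(iii) `CampaignW31EdgeHilbFiniteRange p` (finitely many edge Hilbert functions along `Sing(E)_cl`; intended input: finite
generation of `℘(E)`, typed `U16_1` = FACT-LIST F-20d/F-21f) and the discharge of `U19_4` (HIRONAKA-L lane: `U19_3_of` in
U19L29 gives the stalkwise Diff-closedness of `℘(E)_ξ` from `Thm4_1`; the passage to `G ⊆ κ[Z]` is p.19 (8)).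

## References (context only; nothing below is a premise)

* H. Hironaka, ms. 2017-03-23, §4.1 (8) p.19 l.27–32, Def. 4.6 p.19, Def. 4.9 p.20, Eq. (34) p.24 — scope only, under
  adjudication. [Hironaka2017]
* V. Cossart, U. Jannsen, S. Saito, LNM 2270 (2020), Def. 2.3, Lemma 2.2. [CossartJannsenSaito2020]
* H. Kawanoue, Publ. RIMS 43 (2007), Lemma 3.1.2.1 (structure of 𝔇-saturated graded subalgebras). [Kawanoue2007]
-/

noncomputable section

set_option linter.dupNamespace false -- mandated namespace of this single-conjunct summit

open scoped Polynomial
open IsLocalRing MvPolynomial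

namespace Summit.ResolutionOfSingularities.ResolutionOfSingularities.Theorems

open _root_.AlgebraicGeometry
open Literature.AlgebraicGeometry.Resolution
open Literature.AlgebraicGeometry.Hironaka2017
open Literature.AlgebraicGeometry.Hironaka2017.S02Preliminaries
open Literature.AlgebraicGeometry.Hironaka2017.S04CharAlgebra
open Literature.AlgebraicGeometry.Hironaka2017.EdgeHilbert
open Literature.RingTheory.MvPolynomial

universe u

namespace CampaignW31

/-! ## Hasse–Schmidt stability of the pulled-back edge algebra from Diff-closedness of `edgeG` -/

section DiffStable

variable {O : Type u} [CommRing O] [IsLocalRing O] {n : ℕ}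
  (z : Fin n → O) (hz : Ideal.span (Set.range z) = maximalIdeal O)

/-- If row 004's set `edgeG P z` is stable under every `κ`-linear differential operator of `κ[Z]` (the shape of the typed
candidate `U19_4`, «`G` must be Diff-closed»), then the `κ`-subalgebra with that carrier is stable under all Hasse–Schmidt
derivations (tree `Resolution.IsDiffStable`; `D^{(β)} ∈ Diff^{≤|β|}` is tree `hasseDeriv_mem_diffOp`). [folklore] -/
theorem isDiffStable_of_coe_eq_edgeG (P : Subalgebra O O[X])
    {U : Subalgebra (ResidueField O) (MvPolynomial (Fin n) (ResidueField O))} (hU : (U : Set _) = edgeG P z hz)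
    (hD : ∀ (m : ℕ) (Dbar : MvPolynomial (Fin n) (ResidueField O) →ₗ[ResidueField O] MvPolynomial (Fin n) (ResidueField O)),
      Dbar ∈ diffOp (ResidueField O) (MvPolynomial (Fin n) (ResidueField O)) m →
        ∀ F ∈ edgeG P z hz, Dbar F ∈ edgeG P z hz) :
    IsDiffStable U := by
  classical
  intro F hF β
  have hF' : F ∈ edgeG P z hz := by rw [← hU]; exact hF
  have h := hD β.degree (hasseDeriv (ResidueField O) β) (hasseDeriv_mem_diffOp (ResidueField O) β) F hF'
  rw [← SetLike.mem_coe, hU]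
  exact h

end DiffStable

/-! ## A presentation `U = κ[ℓ_1^{q_1}, …, ℓ_r^{q_r}]` is a minimum system of homogeneous generators of `(edgeGPos)` -/

section Presentation

variable {K : Type u} [Field K] {n : ℕ}

/-- Every element of `K[S] = Algebra.adjoin K S` is a constant plus an element of the ideal `(S)`. [folklore] -/
theorem exists_sub_C_mem_span_of_mem_adjoin (S : Set (MvPolynomial (Fin n) K)) {g : MvPolynomial (Fin n) K}
    (hg : g ∈ Algebra.adjoin K S) : ∃ c : K, g - C c ∈ Ideal.span S := by
  induction hg using Algebra.adjoin_induction with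
  | mem x hx => exact ⟨0, by rw [C_0, sub_zero]; exact Ideal.subset_span hx⟩
  | algebraMap c => exact ⟨c, by rw [MvPolynomial.algebraMap_eq, sub_self]; exact zero_mem _⟩
  | add x y _ _ hx hy =>
    obtain ⟨c, hc⟩ := hx
    obtain ⟨d, hd⟩ := hy
    exact ⟨c + d, by rw [C_add, add_sub_add_comm]; exact add_mem hc hd⟩
  | mul x y _ _ hx hy =>
    obtain ⟨c, hc⟩ := hx
    obtain ⟨d, hd⟩ := hy
    refine ⟨c * d, ?_⟩
    have e : x * y - C (c * d) = x * (y - C d) + C d * (x - C c) := by rw [C_mul]; ring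
    rw [e]
    exact add_mem (Ideal.mul_mem_left _ _ hd) (Ideal.mul_mem_left _ _ hc)

/-- A homogeneous element of POSITIVE degree of `K[S]`, `S` consisting of polynomials without constant term, lies in the
ideal `(S)`. [folklore] -/
theorem mem_span_of_mem_adjoin_of_isHomogeneous (S : Set (MvPolynomial (Fin n) K))
    (hS : ∀ s ∈ S, constantCoeff s = 0) {g : MvPolynomial (Fin n) K} (hg : g ∈ Algebra.adjoin K S) {d : ℕ}
    (hgd : g.IsHomogeneous d) (hd : 1 ≤ d) : g ∈ Ideal.span S := by
  obtain ⟨c, hc⟩ := exists_sub_C_mem_span_of_mem_adjoin S hg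
  have hker : Ideal.span S ≤ RingHom.ker (constantCoeff : MvPolynomial (Fin n) K →+* K) :=
    Ideal.span_le.2 fun s hs => (RingHom.mem_ker).2 (hS s hs)
  have h1 : constantCoeff (g - C c) = 0 := (RingHom.mem_ker).1 (hker hc)
  have h2 : constantCoeff g = 0 := by
    rw [constantCoeff_eq, hgd.coeff_eq_zero]
    intro h0
    simp only [map_zero] at h0
    omega
  rw [map_sub, constantCoeff_C, h2, zero_sub, neg_eq_zero] at h1
  rw [h1, C_0, sub_zero] at hc
  exact hc

/-- The generators `ℓ_j^{q_j}` of a presentation are homogeneous of degree `q_j`. [folklore] -/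
theorem isHomogeneous_form_pow {p : ℕ} {U : Subalgebra K (MvPolynomial (Fin n) K)} (P₀ : EdgeAlgebra.Presentation p U)
    (j : Fin P₀.r) : (P₀.form j ^ P₀.q j).IsHomogeneous (P₀.q j) := by
  simpa using (isHomogeneous_one_of_mem_span (P₀.mem_span j)).pow (P₀.q j)

/-- `X_j^{q} ∉ (X_i^{q_i} : i ≠ j)` in `K[Y_1, …, Y_r]` for `q_i ≥ 1` (evaluate at the `j`-th coordinate point). [folklore] -/
theorem X_pow_notMem_span_image {r : ℕ} (q : Fin r → ℕ) (hq : ∀ i, 1 ≤ q i) (j : Fin r) (e : ℕ) :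
    (X j : MvPolynomial (Fin r) K) ^ e ∉ Ideal.span ((fun i => (X i : MvPolynomial (Fin r) K) ^ q i) '' {i | i ≠ j}) := by
  classical
  intro h
  let ε : MvPolynomial (Fin r) K →+* K := eval fun i => if i = j then 1 else 0
  have hker : Ideal.span ((fun i => (X i : MvPolynomial (Fin r) K) ^ q i) '' {i | i ≠ j}) ≤ RingHom.ker ε := by
    refine Ideal.span_le.2 ?_
    rintro _ ⟨i, hi, rfl⟩
    rw [SetLike.mem_coe, RingHom.mem_ker, map_pow, eval_X, if_neg hi, zero_pow]
    exact Nat.one_le_iff_ne_zero.mp (hq i)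
  have h0 : ε ((X j : MvPolynomial (Fin r) K) ^ e) = 0 := (RingHom.mem_ker).1 (hker h)
  rw [map_pow, eval_X, if_pos rfl, one_pow] at h0
  exact one_ne_zero h0

/-- In a presentation, `ℓ_j^{q_j} ∉ (ℓ_i^{q_i} : i ≠ j)`: transport to `K[Y]` by the retraction `ℓ_j ↦ Y_j` (tree
`Resolution.exists_algHom_linearForm_eq_X`). [folklore] -/
theorem form_pow_notMem_span_image {p : ℕ} [ExpChar K p] {U : Subalgebra K (MvPolynomial (Fin n) K)}
    (P₀ : EdgeAlgebra.Presentation p U) (j : Fin P₀.r) :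
    P₀.form j ^ P₀.q j ∉ Ideal.span ((fun i => P₀.form i ^ P₀.q i) '' {i | i ≠ j}) := by
  classical
  choose c hc using fun i => exists_linearForm_eq_of_mem_span (P₀.mem_span i)
  have hform : (fun i => linearForm K (c i)) = P₀.form := funext hc
  have hcli : LinearIndependent K c :=
    linearIndependent_of_linearIndependent_linearForm c (by rw [hform]; exact P₀.linearIndependent)
  obtain ⟨ψ, hψ⟩ := exists_algHom_linearForm_eq_X c hcli
  intro h
  have h1 := Ideal.mem_map_of_mem ψ.toRingHom h
  rw [Ideal.map_span, ← Set.image_comp] at h1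
  have e1 : ψ.toRingHom (P₀.form j ^ P₀.q j) = (X j : MvPolynomial (Fin P₀.r) K) ^ P₀.q j := by
    rw [AlgHom.toRingHom_eq_coe, RingHom.coe_coe, map_pow, ← hc j, hψ j]
  have e2 : (⇑ψ.toRingHom ∘ fun i => P₀.form i ^ P₀.q i) = fun i => (X i : MvPolynomial (Fin P₀.r) K) ^ P₀.q i := by
    funext i
    simp only [Function.comp_apply, AlgHom.toRingHom_eq_coe, RingHom.coe_coe, map_pow]
    rw [← hc i, hψ i]
  rw [e1, e2] at h1
  exact X_pow_notMem_span_image P₀.q P₀.one_le_q j _ h1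

variable {O : Type u} [CommRing O] [IsLocalRing O] (z : Fin n → O) (hz : Ideal.span (Set.range z) = maximalIdeal O)

/-- **A presentation `U = κ[ℓ^q]` of the pulled-back edge algebra is a minimum system of homogeneous generators of the edge
ideal `(edgeGPos)`** (row 004's `IsMinHomogGens` over row 005's `edgeGPos n P z` = positive-degree homogeneous members
of `edgeG P z = ↑U`). [folklore] -/
theorem isMinHomogGens_presentation {p : ℕ} [ExpChar (ResidueField O) p] (P : Subalgebra O O[X])
    {U : Subalgebra (ResidueField O) (MvPolynomial (Fin n) (ResidueField O))} (hU : (U : Set _) = edgeG P z hz)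
    (P₀ : EdgeAlgebra.Presentation p U) :
    IsMinHomogGens (edgeGPos n P z hz) (fun j => P₀.form j ^ P₀.q j) := by
  have hmemU : ∀ j, P₀.form j ^ P₀.q j ∈ U := fun j => by
    have h : P₀.form j ^ P₀.q j ∈
        Algebra.adjoin (ResidueField O) (Set.range fun j => P₀.form j ^ p ^ P₀.expo j) :=
      Algebra.subset_adjoin ⟨j, rfl⟩
    rwa [← P₀.eq_adjoin] at h
  have hmemPos : ∀ j, P₀.form j ^ P₀.q j ∈ edgeGPos n P z hz := fun j =>
    ⟨by rw [← hU]; exact hmemU j, P₀.q j, P₀.one_le_q j, isHomogeneous_form_pow P₀ j⟩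
  refine ⟨fun j => ⟨hmemPos j, ?_, P₀.q j, isHomogeneous_form_pow P₀ j⟩, ?_, fun j => form_pow_notMem_span_image P₀ j⟩
  · exact pow_ne_zero _ (P₀.linearIndependent.ne_zero j)
  · apply le_antisymm
    · exact Ideal.span_mono (Set.range_subset_iff.2 hmemPos)
    · refine Ideal.span_le.2 fun g hg => ?_
      obtain ⟨hgU, d, hd, hgd⟩ := hg
      have hgU' : g ∈ Algebra.adjoin (ResidueField O) (Set.range fun j => P₀.form j ^ p ^ P₀.expo j) := by
        rw [← P₀.eq_adjoin, ← SetLike.mem_coe, hU]; exact hgU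
      refine mem_span_of_mem_adjoin_of_isHomogeneous _ ?_ hgU' hgd hd
      rintro _ ⟨j, rfl⟩
      rw [constantCoeff_eq, (isHomogeneous_form_pow P₀ j).coeff_eq_zero]
      intro h0
      simp only [map_zero] at h0
      exact absurd h0.symm (Nat.one_le_iff_ne_zero.mp (P₀.one_le_q j))

/-- Equal exponent LISTS have equal lattice-point Hilbert functions. [folklore] -/
theorem hilb_eq_of_ofFn_eq {r k : ℕ} {f : Fin r → ℕ} {g : Fin k → ℕ} (h : List.ofFn f = List.ofFn g) (a : ℕ) :
    hilb f a = hilb g a := by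
  have hr : r = k := by simpa using congrArg List.length h
  subst hr
  rw [List.ofFn_injective h]

/-- **The Hilbert function of the pulled-back edge algebra is `N(q; ·)` for the degrees `q` of ANY minimum system of
homogeneous generators of the edge ideal with non-decreasing degrees** (`κ` perfect of characteristic `p`, `U` graded and
Hasse–Schmidt stable): both that system and a presentation `κ[ℓ^q]` (tree structure theorem
`Resolution.exists_eq_adjoin_pow_linearForms_of_isDiffStable`) are Cossart–Jannsen–Saito standard bases of the same ideal
(res-type-005's `isStandardBase_of_isMinHomogGens`), so their degree sequences agree (`ofFn_eq_of_isStandardBase`,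
CJS Lemma 2.2). [folklore] -/
theorem hilbFun_eq_hilb_of_isMinHomogGens {p : ℕ} [ExpChar (ResidueField O) p] [PerfectRing (ResidueField O) p]
    (P : Subalgebra O O[X]) {U : Subalgebra (ResidueField O) (MvPolynomial (Fin n) (ResidueField O))}
    (hU : (U : Set _) = edgeG P z hz) (hUg : IsGradedSubalgebra U) (hUd : IsDiffStable U)
    {r : ℕ} {gbar : Fin r → MvPolynomial (Fin n) (ResidueField O)} {q : Fin r → ℕ}
    (hmin : IsMinHomogGens (edgeGPos n P z hz) gbar) (hhom : ∀ j, (gbar j).IsHomogeneous (q j)) (hq : Monotone q)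
    (a : ℕ) : EdgeAlgebra.hilbFun U a = hilb q a := by
  let P₀ : EdgeAlgebra.Presentation p U := Classical.choice (EdgeAlgebra.nonempty_presentation p U hUg hUd)
  have h1 := isStandardBase_of_isMinHomogGens hmin hhom hq
  have h2 := isStandardBase_of_isMinHomogGens (isMinHomogGens_presentation z hz P hU P₀)
    (fun j => isHomogeneous_form_pow P₀ j) P₀.monotone_q
  have e : List.ofFn q = List.ofFn P₀.q := ofFn_eq_of_isStandardBase h1 h2 fun _ => rfl
  rw [P₀.hilbFun_eq a, hilb_eq_of_ofFn_eq e]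

end Presentation

end CampaignW31

open CampaignW31

/-! ## Piece (ii) of the slot: the dictionary, modulo `U19_4` -/

/-- **[OURS · L1 W3.1] piece (ii) `CampaignW31EdgeHilbDictionary p` FOLLOWS from the typed candidate `U19_4`** (§4.1 (8)
p.19 l.31–32 «so that `G` must be Diff-closed in view of Eq.(22)», `S04CharAlgebra.U19_4`, row 004 — consumed as a
HYPOTHESIS for every perfect ambient datum, NOT asserted): for every perfect `K` of characteristic `p`, ambient datum `A`,
`n`, standard `E`, closed `ξ ∈ Sing(E)`, edge data `D` with the Def. 4.9 provenance (`S04CharAlgebra.IsEdgeData`) and degree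
`a`, `dim_{κ(ξ)} G(ξ)_a = N(q(D); a)`. Kernel route: `A.Z` is regular (smooth over a field) and locally Noetherian; the edge
algebra pulled back along the r.s.p. of the provenance datum is a graded (`isGradedSubalgebra_edgeG`) Hasse–Schmidt-stable
(`U19_4` + `isDiffStable_of_coe_eq_edgeG`) `κ(ξ)`-subalgebra of `κ(ξ)[Z]`, `κ(ξ)` perfect (D-lane `U20_3_holds`); its Hilbert
function is `edgeHilbAt` (`edgeHilbAt_eq_hilbFun`, p477733) and equals `N(q(D); ·)` (`hilbFun_eq_hilb_of_isMinHomogGens`,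
degrees sorted by res-type-005's `monotone_q`). Replaces the role of the silent identification behind Eq. (34); NOT a
statement of the manuscript. [folklore] -/
theorem campaignW31EdgeHilbDictionary_of_U19_4 (p : ℕ) [Fact p.Prime]
    (hG : ∀ (K : Type u) [Field K] [CharP K p] [PerfectField K] (A : AmbientDatum p K) (E : IdealExponent A.Z),
      U19_4 p A.hom E) :
    CampaignW31EdgeHilbDictionary.{u} p := by
  intro K _ _ _ A n E hE ξ hξ D hD a
  obtain ⟨z, hz, gbar, hhom, hmin, -, -⟩ := hD
  haveI := A.smooth
  haveI : IsLocallyNoetherian A.Z := LocallyOfFiniteType.isLocallyNoetherian A.hom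
  have hR : Scheme.IsRegular A.Z := Scheme.IsRegular.of_smooth A.hom (Scheme.isRegular_Spec (.of K))
  have hA : IsAmbient p A.hom := ⟨(Fact.out : p.Prime).pos, A.irreducible, A.smooth, A.quasiCompact⟩
  obtain ⟨U, hU⟩ := exists_subalgebra_coe_eq_edgeG z hz.2.1 (pStalk E ξ)
  have hUg : IsGradedSubalgebra U := isGradedSubalgebra_edgeG hR E ξ hz.2.1 hU
  have hUd : IsDiffStable U := isDiffStable_of_coe_eq_edgeG z hz.2.1 (pStalk E ξ) hU
    fun m Dbar hDbar F hF => hG K A E hA inferInstance hE ξ hξ.1 hξ.2 n z hz m Dbar hDbar F hF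
  -- the residue field is perfect of characteristic `p`
  letI := stalkAlgebra (kStructure A.hom) ξ
  haveI : PerfectField (ResidueField (A.Z.presheaf.stalk ξ)) :=
    (U20_3_holds p A.hom E hA inferInstance hE ξ hξ.1 hξ.2).2.2.1
  haveI : CharP (ResidueField (A.Z.presheaf.stalk ξ)) p :=
    charP_of_injective_algebraMap (algebraMap K (ResidueField (A.Z.presheaf.stalk ξ))).injective p
  haveI : ExpChar (ResidueField (A.Z.presheaf.stalk ξ)) p := ExpChar.prime Fact.out
  haveI : PerfectRing (ResidueField (A.Z.presheaf.stalk ξ)) p := PerfectField.toPerfectRing p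
  rw [edgeHilbAt_eq_hilbFun hR E ξ hz hU a]
  exact_mod_cast hilbFun_eq_hilb_of_isMinHomogGens (p := p) z hz.2.1 (pStalk E ξ) hU hUg hUd hmin hhom
    (CampaignW31.monotone_q D) a

/-- **[OURS · L1 W3.1] the slot statement modulo `U19_4` and (iii)**: with (i) `CampaignW31EdgeHilbLsc_holds` (res-L1-s31-pv-2,
p474858, unconditional), (ii) from `U19_4` (this file) and (iii) `CampaignW31EdgeHilbFiniteRange p` as the remaining hypothesis,
the assembly of res-L1-k31 (p467881, `campaignW31UscInvOneExponentI_of_edgeHilb`) yields `CampaignW31UscInvOneExponentI p`: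
upper semicontinuity of `ξ ↦ Inv_ξ(E)` on `Sing(E)_cl` for ONE standard ideal exponent. NOT a statement of the manuscript.
[folklore] -/
theorem campaignW31UscInvOneExponentI_of_U19_4 (p : ℕ) [Fact p.Prime]
    (hG : ∀ (K : Type u) [Field K] [CharP K p] [PerfectField K] (A : AmbientDatum p K) (E : IdealExponent A.Z),
      U19_4 p A.hom E)
    (hfin : CampaignW31EdgeHilbFiniteRange.{u} p) : CampaignW31UscInvOneExponentI.{u} p :=
  campaignW31UscInvOneExponentI_of_edgeHilb p (CampaignW31EdgeHilbLsc_holds p)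
    (campaignW31EdgeHilbDictionary_of_U19_4 p hG) hfin

/-- **[OURS · L1 W3.1] `Inv_max` attained and the `Inv_max`-stratum closed, modulo `U19_4` and (iii)** (res-L1-k31's
`campaignW31InvmaxClosedI_of_edgeHilb`, p467881). NOT a statement of the manuscript. [folklore] -/
theorem campaignW31InvmaxClosedI_of_U19_4 (p : ℕ) [Fact p.Prime]
    (hG : ∀ (K : Type u) [Field K] [CharP K p] [PerfectField K] (A : AmbientDatum p K) (E : IdealExponent A.Z),
      U19_4 p A.hom E)
    (hfin : CampaignW31EdgeHilbFiniteRange.{u} p) : CampaignW31InvmaxClosedI.{u} p :=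
  campaignW31InvmaxClosedI_of_edgeHilb p (CampaignW31EdgeHilbLsc_holds p)
    (campaignW31EdgeHilbDictionary_of_U19_4 p hG) hfin

end Summit.ResolutionOfSingularities.ResolutionOfSingularities.Theorems

end
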